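import Mathlib
import HarnessLib.Audit
import Summits.PneNP.PneNP.Theorems.PstarGateBridge
import Summits.PneNP.PneNP.Theorems.PstarChordBridgeForest
import Summits.PneNP.PneNP.Theorems.PstarGateTerminal

/-!
# One GATED chord: the CLEAN COMPANION bridge data (chords `N − e`, first constraint `R + ℓ`) is well formed, infeasible, and in CASE P chord-minimal (prover-1 g18)

FRONTIER range-avoidance ladder, rung F-N3 (`stmt-PneNP-19007`), cell `pnp-ideate` (this seat's `HOME/pnp-ideate-prover-1/g18/E2-PLAN.md` §0, §3);
restricted-model proof complexity — nothing here bears on `P` versus `NP`.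

INSTANCE form of the ungated companion.  For one-gate bridge data `B` (`PstarGateBridge.GateHyp`: the gate `g₀ = (p, u)` on the private `p = vars e 2`
of the chord `e`, coefficient `κ₀ + x_u`) the COMPANION data `companion I B e g₀ u κ₀` keep the core `J₀`, the fundamental sets and joins, the second
constraint, and replace: chords `N ↦ N − e` (the gated chord becomes a non-chord: its cycle `D e + e` joins the "forest"), first constraint
`(C₁, G₁, b₁) ↦ ((C₁ − p) ∆ {u}, G₁ − g₀, b₁ + κ₀)` — the clean member `R + ℓ` of the memo.  Results:

* `companion_wf` — the companion is well formed (`D e' ⊆ J₀ ∖ (N − e)`, the joins are unchanged because the endpoints of `e` are already XOR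
  vertices of the forest, no cross pendant);
* `companion_hun` — its pendants touch NO private of `N − e` (privates unread: the clean chain's standing hypothesis HOLDS for the companion);
* `sys_companion_ρ`, `free₂_companion`, `free₁_companion` — its chord system: same prescribed products, same reads of the chords `≠ e`, `F₂` unchanged,
  `F₁ ↦ F₁ + x_u`; `val_companion` — its value at `s` is the original value at `s` with `e` switched ON-first (`(1, u_e)`), shifted by `κ₀`;
* `infeasible_companion` — **(T3) transfers**; `chordMinimal_companion_of_singleRead` — **in CASE P every chord `e' ≠ e` that is chord-minimal for
  the original model is chord-minimal for the companion** (`PstarGateRegime.forced_of_singleRead_at`: at a witness on `Z` the read gate is ON).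
So in CASE P the companion is a privates-unread, single-read, constant-read, infeasible chord system, chord-minimal in every chord — the clean chain's
MODEL-level structure theorems apply to the chords other than `e` verbatim.  (Not inherited: `Lift`/peelability of `J₀ ∖ (N − e)`, which contains
the cycle `D e + e`.)
-/

set_option linter.dupNamespace false -- `Summit.PneNP.PneNP.…`: summit = sub-problem name (D-0017 single-conjunct layout)

open Finset Literature.Computability.Complexity
open scoped symmDiff
open Summit.PneNP.PneNP.Theorems.PstarFibrePolys (bit)
open Summit.PneNP.PneNP.Theorems.PstarTyped (Typed)
open Summit.PneNP.PneNP.Theorems.PstarSALevel (varSet bdry)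
open Summit.PneNP.PneNP.Theorems.PstarXCore (xpair xverts mem_xpair)
open Summit.PneNP.PneNP.Theorems.PstarChordRepair (IsChord)
open Summit.PneNP.PneNP.Theorems.PstarReadSumset (V2)
open Summit.PneNP.PneNP.Theorems.PstarChordSystem (ChordSystem)
open Summit.PneNP.PneNP.Theorems.PstarChordBridgeTools
open Summit.PneNP.PneNP.Theorems.PstarChordBridge
open Summit.PneNP.PneNP.Theorems.PstarChordBridgeFundamental (odd_of_end)
open Summit.PneNP.PneNP.Theorems.PstarChordBridgeCotree (mem_xverts_iff_xpdeg_pos)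
open Summit.PneNP.PneNP.Theorems.PstarChordBridgeForcing (coef_of_unread)
open Summit.PneNP.PneNP.Theorems.PstarChordBridgeForest (privs_erase)
open Summit.PneNP.PneNP.Theorems.PstarGraphQuadGapTwoForms (sum_symmDiff_zmod2)
open Summit.PneNP.PneNP.Theorems.PstarGateRegime (forced_of_singleRead_at)
open Summit.PneNP.PneNP.Theorems.PstarGateBridge (GateHyp gate_reads priv_ne_of_ne)
open Summit.PneNP.PneNP.Theorems.PstarGateTerminal (coef_single_gate)

namespace Summit.PneNP.PneNP.Theorems.PstarGateCompanion

variable {n m : ℕ}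

/-- Every element of `𝔽₂` is `0` or `1`. -/
private theorem zmod2_cases (t : ZMod 2) : t = 0 ∨ t = 1 := by
  revert t; decide
/-! ## The companion data -/
/-- **The clean companion** of one-gate bridge data: chords `N − e`, first constraint `((C₁ − p) ∆ {u}, G₁ − g₀, b₁ + κ₀)`. -/
def companion (I : LocalMap 4 n m) (B : BridgeData n m) (e g₀ : Fin m) (u : Fin n) (κ₀ : Bool) : BridgeData n m :=
  { B with N := B.N.erase e, C₁ := (B.C₁.erase (I.vars e 2)) ∆ {u}, G₁ := B.G₁.erase g₀, b₁ := xor B.b₁ κ₀ }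

section Unfold
variable (I : LocalMap 4 n m) (B : BridgeData n m) (e g₀ : Fin m) (u : Fin n) (κ₀ : Bool)
/-- Unfolding. -/ @[simp] theorem companion_y : (companion I B e g₀ u κ₀).y = B.y := rfl
/-- Unfolding. -/ @[simp] theorem companion_J₀ : (companion I B e g₀ u κ₀).J₀ = B.J₀ := rfl
/-- Unfolding. -/ @[simp] theorem companion_N : (companion I B e g₀ u κ₀).N = B.N.erase e := rfl
/-- Unfolding. -/ @[simp] theorem companion_D : (companion I B e g₀ u κ₀).D = B.D := rfl
/-- Unfolding. -/ @[simp] theorem companion_C₁ : (companion I B e g₀ u κ₀).C₁ = (B.C₁.erase (I.vars e 2)) ∆ {u} := rfl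
/-- Unfolding. -/ @[simp] theorem companion_G₁ : (companion I B e g₀ u κ₀).G₁ = B.G₁.erase g₀ := rfl
/-- Unfolding. -/ @[simp] theorem companion_b₁ : (companion I B e g₀ u κ₀).b₁ = xor B.b₁ κ₀ := rfl
/-- Unfolding. -/ @[simp] theorem companion_T₁ : (companion I B e g₀ u κ₀).T₁ = B.T₁ := rfl
/-- Unfolding. -/ @[simp] theorem companion_C₂ : (companion I B e g₀ u κ₀).C₂ = B.C₂ := rfl
/-- Unfolding. -/ @[simp] theorem companion_G₂ : (companion I B e g₀ u κ₀).G₂ = B.G₂ := rfl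
/-- Unfolding. -/ @[simp] theorem companion_b₂ : (companion I B e g₀ u κ₀).b₂ = B.b₂ := rfl
/-- Unfolding. -/ @[simp] theorem companion_T₂ : (companion I B e g₀ u κ₀).T₂ = B.T₂ := rfl
end Unfold

/-- The non-chords of the companion: the forest plus `e`. -/
theorem sdiff_companion {B : BridgeData n m} (hN : B.N ⊆ B.J₀) {e : Fin m} (he : e ∈ B.N) :
    B.J₀ \ B.N.erase e = insert e (B.J₀ \ B.N) := by
  ext k
  rw [mem_sdiff, mem_erase, mem_insert, mem_sdiff]
  constructor
  · rintro ⟨hk, h⟩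
    by_cases hke : k = e
    · exact Or.inl hke
    · exact Or.inr ⟨hk, fun hkN => h ⟨hke, hkN⟩⟩
  · rintro (rfl | ⟨hk, hkN⟩)
    · exact ⟨hN he, fun h => h.1 rfl⟩
    · exact ⟨hk, fun h => hkN h.2⟩

/-- The endpoints of a chord are XOR vertices of the forest (its fundamental set reaches them). -/
theorem xpair_subset_xverts (I : LocalMap 4 n m) (hI : I.IsPure xorAndPred) {B : BridgeData n m} (hW : B.WF I) {e : Fin m} (he : e ∈ B.N) :
    xpair I e ⊆ xverts I (B.J₀ \ B.N) := by
  intro w hw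
  have heD : e ∉ B.D e := fun h => (mem_sdiff.1 (hW.hD e he h)).2 he
  have hsub : xverts I (B.D e) ⊆ xverts I (B.J₀ \ B.N) := by
    unfold PstarXCore.xverts; exact biUnion_subset_biUnion_of_subset_left _ (hW.hD e he)
  refine hsub ((mem_xverts_iff_xpdeg_pos I _ w).2 ?_)
  rcases (mem_xpair I).1 hw with rfl | rfl
  · exact (odd_of_end I hI heD (hW.hDeven e he) (s := 0) (by decide)).pos
  · exact (odd_of_end I hI heD (hW.hDeven e he) (s := 1) (by decide)).pos

/-- So the companion's non-chords have the same XOR vertices. -/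
theorem xverts_companion (I : LocalMap 4 n m) (hI : I.IsPure xorAndPred) {B : BridgeData n m} (hW : B.WF I) {e : Fin m} (he : e ∈ B.N) :
    xverts I (B.J₀ \ B.N.erase e) = xverts I (B.J₀ \ B.N) := by
  rw [sdiff_companion hW.hN he]
  unfold PstarXCore.xverts
  rw [biUnion_insert]
  exact union_eq_right.2 (xpair_subset_xverts I hI hW he)

/-- **The companion is well formed.** -/
theorem companion_wf (I : LocalMap 4 n m) (hI : I.IsPure xorAndPred) (hT : Typed I) {B : BridgeData n m} (hW : B.WF I) {e : Fin m} (hG : GateHyp I B e)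
    (g₀ : Fin m) {u : Fin n} (hux : u ∉ xverts I (B.J₀ \ B.N)) (κ₀ : Bool) : (companion I B e g₀ u κ₀).WF I := by
  have he := hG.1
  have hxv := xverts_companion I hI hW he
  have hsub : B.J₀ \ B.N ⊆ B.J₀ \ B.N.erase e := sdiff_subset_sdiff (subset_refl _) (erase_subset _ _)
  have hprivs : privs I (B.N.erase e) ⊆ privs I B.N := by
    intro v hv; exact ((privs_erase I hW.hN hW.hchord he v).1 hv).1
  refine { hN := ?_, hchord := ?_, hD := ?_, hDeven := ?_, hT₁ := ?_, hT₂ := ?_, hjoin₁ := ?_, hjoin₂ := ?_, hcross₁ := ?_, hcross₂ := ?_ }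
  · exact (erase_subset _ _).trans hW.hN
  · intro e' he'; exact hW.hchord e' (mem_of_mem_erase he')
  · intro e' he'; exact (hW.hD e' (mem_of_mem_erase he')).trans hsub
  · intro e' he'; exact hW.hDeven e' (mem_of_mem_erase he')
  · exact hW.hT₁.trans hsub
  · exact hW.hT₂.trans hsub
  · -- the first join: `u`, `p` are AND-type, never XOR vertices
    intro w
    show Odd (xpdeg I B.T₁ w) ↔ w ∈ (B.C₁.erase (I.vars e 2)) ∆ {u} ∧ w ∈ xverts I (B.J₀ \ B.N.erase e)
    rw [hW.hjoin₁ w, hxv]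
    simp only [mem_symmDiff, mem_erase, mem_singleton]
    constructor
    · rintro ⟨hC, hx⟩
      have hwp : w ≠ I.vars e 2 := fun h => not_mem_xverts_of_two_le I hT _ e (s := 2) (by decide) (h ▸ hx)
      have hwu : w ≠ u := fun h => hux (h ▸ hx)
      exact ⟨Or.inl ⟨⟨hwp, hC⟩, hwu⟩, hx⟩
    · rintro ⟨(⟨⟨-, hC⟩, -⟩ | ⟨rfl, -⟩), hx⟩
      · exact ⟨hC, hx⟩
      · exact absurd hx hux
  · intro w
    show Odd (xpdeg I B.T₂ w) ↔ w ∈ B.C₂ ∧ w ∈ xverts I (B.J₀ \ B.N.erase e)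
    rw [hW.hjoin₂ w, hxv]
  · intro g hg h
    exact hW.hcross₁ g (mem_of_mem_erase hg) ⟨hprivs h.1, hprivs h.2⟩
  · intro g hg h
    exact hW.hcross₂ g hg ⟨hprivs h.1, hprivs h.2⟩

/-- An AND slot of any output is not an XOR vertex (typed instance). -/
theorem not_mem_xverts_of_and_slot (I : LocalMap 4 n m) (hT : Typed I) (E : Finset (Fin m)) {g : Fin m} {u : Fin n}
    (hu : I.vars g 2 = u ∨ I.vars g 3 = u) : u ∉ xverts I E := by
  rcases hu with h | h
  · rw [← h]; exact not_mem_xverts_of_two_le I hT E g (s := 2) (by decide)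
  · rw [← h]; exact not_mem_xverts_of_two_le I hT E g (s := 3) (by decide)

/-- **Privates unread for the companion**: no pendant of either constraint touches a private of `N − e`. -/
theorem companion_hun (I : LocalMap 4 n m) {B : BridgeData n m} (hW : B.WF I) {e : Fin m} (hG : GateHyp I B e) (g₀ : Fin m) (u : Fin n) (κ₀ : Bool) :
    ∀ v ∈ privs I (companion I B e g₀ u κ₀).N,
      (∀ g ∈ (companion I B e g₀ u κ₀).G₁, I.vars g 2 ≠ v ∧ I.vars g 3 ≠ v) ∧ ∀ g ∈ (companion I B e g₀ u κ₀).G₂, I.vars g 2 ≠ v ∧ I.vars g 3 ≠ v := by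
  intro v hv
  rw [companion_N] at hv
  obtain ⟨hvN, hvp, -⟩ := (privs_erase I hW.hN hW.hchord hG.1 v).1 hv
  obtain ⟨h1, h2⟩ := hG.2.1 v hvN hvp
  rw [companion_G₁, companion_G₂]
  exact ⟨fun g hg => h1 g (mem_of_mem_erase hg), h2⟩

/-- **The reads of the chords `≠ e` are unchanged** (their privates are neither `p` nor `u`, and `g₀` does not touch them). -/
theorem coef_companion (I : LocalMap 4 n m) {B : BridgeData n m} (hW : B.WF I) {e : Fin m} (hG : GateHyp I B e) {g₀ : Fin m} (hg₀ : g₀ ∈ B.G₁)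
    {u : Fin n} (hgv : (I.vars g₀ 2 = I.vars e 2 ∧ I.vars g₀ 3 = u) ∨ (I.vars g₀ 2 = u ∧ I.vars g₀ 3 = I.vars e 2)) (hu : u ∉ privs I B.N)
    {v : Fin n} (hv : v ∈ privs I (B.N.erase e)) (x : Fin n → ZMod 2) :
    coef I ((B.C₁.erase (I.vars e 2)) ∆ {u}) (B.G₁.erase g₀) v x = coef I B.C₁ B.G₁ v x := by
  classical
  obtain ⟨hvN, hvp, -⟩ := (privs_erase I hW.hN hW.hchord hG.1 v).1 hv
  have hvu : v ≠ u := fun h => hu (h ▸ hvN)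
  unfold coef
  congr 1
  · have hmem : (v ∈ (B.C₁.erase (I.vars e 2)) ∆ {u}) ↔ v ∈ B.C₁ := by
      rw [mem_symmDiff, mem_erase, mem_singleton]
      constructor
      · rintro (⟨⟨-, h⟩, -⟩ | ⟨h, -⟩)
        · exact h
        · exact absurd h hvu
      · intro h; exact Or.inl ⟨⟨hvp, h⟩, hvu⟩
    simp only [hmem]
  · rw [← add_sum_erase B.G₁ _ hg₀]
    have h0 : (if I.vars g₀ 2 = v then x (I.vars g₀ 3) else 0) + (if I.vars g₀ 3 = v then x (I.vars g₀ 2) else 0) = 0 := by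
      rcases hgv with ⟨h2, h3⟩ | ⟨h2, h3⟩
      · rw [if_neg (by rw [h2]; exact Ne.symm hvp), if_neg (by rw [h3]; exact Ne.symm hvu), add_zero]
      · rw [if_neg (by rw [h2]; exact Ne.symm hvu), if_neg (by rw [h3]; exact Ne.symm hvp), add_zero]
    rw [h0, zero_add]

/-- The companion's model reads of a chord `e' ≠ e`. -/
theorem sys_companion_ρ (I : LocalMap 4 n m) {B : BridgeData n m} (hW : B.WF I) {e : Fin m} (hG : GateHyp I B e) {g₀ : Fin m} (hg₀ : g₀ ∈ B.G₁)
    {u : Fin n} (hgv : (I.vars g₀ 2 = I.vars e 2 ∧ I.vars g₀ 3 = u) ∨ (I.vars g₀ 2 = u ∧ I.vars g₀ 3 = I.vars e 2)) (hu : u ∉ privs I B.N)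
    (κ₀ : Bool) {e' : Fin m} (he' : e' ∈ B.N.erase e) (x : Fin n → ZMod 2) :
    (sys I (companion I B e g₀ u κ₀)).ρ e' x = (sys I B).ρ e' x ∧ (sys I (companion I B e g₀ u κ₀)).ρ' e' x = (sys I B).ρ' e' x := by
  have he'N : e' ∈ B.N := mem_of_mem_erase he'
  have he'c : e' ∈ (companion I B e g₀ u κ₀).N := by rw [companion_N]; exact he'
  rw [sys_ρ I _ he'c, sys_ρ' I _ he'c, sys_ρ I B he'N, sys_ρ' I B he'N, companion_C₁, companion_G₁, companion_C₂, companion_G₂,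
    coef_companion I hW hG hg₀ hgv hu (vars_mem_privs I he' (s := 2) (by decide)) x,
    coef_companion I hW hG hg₀ hgv hu (vars_mem_privs I he' (s := 3) (by decide)) x]
  exact ⟨rfl, rfl⟩

/-- **The second state-free part is unchanged.** -/
theorem free₂_companion (I : LocalMap 4 n m) (hI : I.IsPure xorAndPred) {B : BridgeData n m} (hW : B.WF I) {e : Fin m} (hG : GateHyp I B e)
    (x : Fin n → ZMod 2) :
    free I B.y (B.J₀ \ B.N.erase e) (B.N.erase e) B.T₂ B.C₂ B.G₂ x = free I B.y (B.J₀ \ B.N) B.N B.T₂ B.C₂ B.G₂ x := by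
  classical
  have he := hG.1
  have hG₂p := hG.2.2.1
  have hC₂p := hG.2.2.2.1
  have hC₂p' := hG.2.2.2.2.2
  have hpp' : I.vars e 3 ≠ I.vars e 2 := fun h => absurd (hI.2 e h) (by decide)
  have hG₂p' : ∀ g ∈ B.G₂, I.vars g 2 ≠ I.vars e 3 ∧ I.vars g 3 ≠ I.vars e 3 :=
    (hG.2.1 _ (vars_mem_privs I he (s := 3) (by decide)) hpp').2
  have hxv := xverts_companion I hI hW he
  unfold free
  rw [hxv]
  congr 1
  · congr 1
    refine sum_congr (filter_congr fun v hv => ?_) fun _ _ => rfl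
    rw [privs_erase I hW.hN hW.hchord he]
    constructor
    · rintro ⟨hx, hp⟩
      exact ⟨hx, fun h => hp ⟨h, fun h' => hC₂p (h' ▸ hv), fun h' => hC₂p' (h' ▸ hv)⟩⟩
    · rintro ⟨hx, hp⟩
      exact ⟨hx, fun h => hp h.1⟩
  · refine sum_congr (filter_congr fun g hg => ?_) fun _ _ => rfl
    rw [privs_erase I hW.hN hW.hchord he, privs_erase I hW.hN hW.hchord he]
    obtain ⟨h2p, h3p⟩ := hG₂p g hg
    obtain ⟨h2p', h3p'⟩ := hG₂p' g hg
    constructor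
    · intro h hor
      exact h (hor.imp (fun h2 => ⟨h2, h2p, h2p'⟩) (fun h3 => ⟨h3, h3p, h3p'⟩))
    · intro h hor
      exact h (hor.imp (fun h2 => h2.1) (fun h3 => h3.1))

/-- **The first state-free part gains `x_u`** (one gate: no monomial other than `g₀` touches `p`). -/
theorem free₁_companion (I : LocalMap 4 n m) (hI : I.IsPure xorAndPred) {B : BridgeData n m} (hW : B.WF I) {e : Fin m} (hG : GateHyp I B e)
    {g₀ : Fin m} (hg₀ : g₀ ∈ B.G₁) {u : Fin n} (hgv : (I.vars g₀ 2 = I.vars e 2 ∧ I.vars g₀ 3 = u) ∨ (I.vars g₀ 2 = u ∧ I.vars g₀ 3 = I.vars e 2))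
    (hu : u ∉ privs I B.N) (hux : u ∉ xverts I (B.J₀ \ B.N)) (hG₁p : ∀ g ∈ B.G₁.erase g₀, I.vars g 2 ≠ I.vars e 2 ∧ I.vars g 3 ≠ I.vars e 2)
    (x : Fin n → ZMod 2) :
    free I B.y (B.J₀ \ B.N.erase e) (B.N.erase e) B.T₁ ((B.C₁.erase (I.vars e 2)) ∆ {u}) (B.G₁.erase g₀) x =
      free I B.y (B.J₀ \ B.N) B.N B.T₁ B.C₁ B.G₁ x + x u := by
  classical
  have he := hG.1
  have hxv := xverts_companion I hI hW he
  have hp : I.vars e 2 ∈ privs I B.N := vars_mem_privs I he (s := 2) (by decide)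
  have hpp' : I.vars e 3 ≠ I.vars e 2 := fun h => absurd (hI.2 e h) (by decide)
  have hC₁p' : I.vars e 3 ∉ B.C₁ := hG.2.2.2.2.1
  have hG₁p' : ∀ g ∈ B.G₁, I.vars g 2 ≠ I.vars e 3 ∧ I.vars g 3 ≠ I.vars e 3 :=
    (hG.2.1 _ (vars_mem_privs I he (s := 3) (by decide)) hpp').1
  have hup : u ≠ I.vars e 2 := fun h => hu (h ▸ hp)
  unfold free
  rw [hxv]
  -- linear part: the filtered set is the old one `∆ {u}`
  have hlin : ((B.C₁.erase (I.vars e 2)) ∆ {u}).filter (fun v => v ∉ xverts I (B.J₀ \ B.N) ∧ v ∉ privs I (B.N.erase e)) =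
      (B.C₁.filter (fun v => v ∉ xverts I (B.J₀ \ B.N) ∧ v ∉ privs I B.N)) ∆ {u} := by
    ext v
    rw [mem_filter, mem_symmDiff, mem_symmDiff, mem_filter, mem_erase, mem_singleton, privs_erase I hW.hN hW.hchord he]
    by_cases hvu : v = u
    · subst hvu
      constructor
      · rintro ⟨(⟨_, hne⟩ | ⟨-, hnot⟩), -, -⟩
        · exact absurd rfl hne
        · exact Or.inr ⟨rfl, fun h => hnot ⟨hup, h.1⟩⟩
      · rintro (⟨_, hne⟩ | ⟨-, hnot⟩)
        · exact absurd rfl hne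
        · exact ⟨Or.inr ⟨rfl, fun h => hnot ⟨h.2, hux, hu⟩⟩, hux, fun h => hu h.1⟩
    · constructor
      · rintro ⟨(⟨⟨hvp, hvC⟩, -⟩ | ⟨h, -⟩), hx, hpr⟩
        · exact Or.inl ⟨⟨hvC, hx, fun h => hpr ⟨h, hvp, fun h' => hC₁p' (h' ▸ hvC)⟩⟩, hvu⟩
        · exact absurd h hvu
      · rintro (⟨⟨hvC, hx, hpr⟩, -⟩ | ⟨h, -⟩)
        · exact ⟨Or.inl ⟨⟨fun h => hpr (h ▸ hp), hvC⟩, hvu⟩, hx, fun h => hpr h.1⟩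
        · exact absurd h hvu
  -- monomial part: `g₀` leaves, nothing else changes
  have hmon : (B.G₁.erase g₀).filter (fun g => ¬ (I.vars g 2 ∈ privs I (B.N.erase e) ∨ I.vars g 3 ∈ privs I (B.N.erase e))) =
      B.G₁.filter (fun g => ¬ (I.vars g 2 ∈ privs I B.N ∨ I.vars g 3 ∈ privs I B.N)) := by
    ext g
    rw [mem_filter, mem_filter, mem_erase, privs_erase I hW.hN hW.hchord he, privs_erase I hW.hN hW.hchord he]
    constructor
    · rintro ⟨⟨hgg, hgG⟩, hnot⟩
      obtain ⟨h2p, h3p⟩ := hG₁p g (mem_erase.2 ⟨hgg, hgG⟩)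
      obtain ⟨h2p', h3p'⟩ := hG₁p' g hgG
      exact ⟨hgG, fun hor => hnot (hor.imp (fun h2 => ⟨h2, h2p, h2p'⟩) (fun h3 => ⟨h3, h3p, h3p'⟩))⟩
    · rintro ⟨hgG, hnot⟩
      refine ⟨⟨?_, hgG⟩, fun hor => hnot (hor.imp (fun h2 => h2.1) (fun h3 => h3.1))⟩
      rintro rfl
      rcases hgv with ⟨h2, -⟩ | ⟨-, h3⟩
      · exact hnot (Or.inl (h2 ▸ hp))
      · exact hnot (Or.inr (h3 ▸ hp))
  rw [hlin, hmon, sum_symmDiff_zmod2, sum_singleton]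
  ring

/-- **The companion's value**: the original value with `e` switched to `(1, u_e)`, shifted by `κ₀` in the first coordinate — stated as the two
coordinate identities the transfers need.  Here `κ₀ = [p ∈ C₁]`. -/
theorem val_companion (I : LocalMap 4 n m) (hI : I.IsPure xorAndPred) {B : BridgeData n m} (hW : B.WF I) {e : Fin m} (hG : GateHyp I B e)
    {g₀ : Fin m} (hg₀ : g₀ ∈ B.G₁) {u : Fin n} (hgv : (I.vars g₀ 2 = I.vars e 2 ∧ I.vars g₀ 3 = u) ∨ (I.vars g₀ 2 = u ∧ I.vars g₀ 3 = I.vars e 2))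
    (hu : u ∉ privs I B.N) (hux : u ∉ xverts I (B.J₀ \ B.N)) (hG₁p : ∀ g ∈ B.G₁.erase g₀, I.vars g 2 ≠ I.vars e 2 ∧ I.vars g 3 ≠ I.vars e 2)
    (κ₀ : Bool) (x : Fin n → ZMod 2) (s : Fin m → ZMod 2 × ZMod 2) :
    (sys I (companion I B e g₀ u κ₀)).val (B.N.erase e) x s + ((if I.vars e 2 ∈ B.C₁ then 1 else 0), 0) =
      (sys I B).val B.N x (Function.update s e (1, (sys I B).u e x)) := by
  classical
  have he := hG.1
  -- split `e` off the original value
  rw [(sys I B).val_eq he, (sys I B).val_erase_update, (sys I B).contrib_update_self, (gate_reads I hI hG x).1, (gate_reads I hI hG x).2,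
    smul_zero, add_zero, one_smul, coef_single_gate I hI hg₀ hgv hG₁p x]
  -- both sides in closed form
  unfold ChordSystem.val
  rw [sys_F, sys_F, companion_y, companion_J₀, companion_N, companion_T₁, companion_C₁, companion_G₁, companion_T₂, companion_C₂, companion_G₂,
    free₁_companion I hI hW hG hg₀ hgv hu hux hG₁p x, free₂_companion I hI hW hG x]
  have hcontrib : ∀ i ∈ B.N.erase e, (sys I (companion I B e g₀ u κ₀)).contrib x s i = (sys I B).contrib x s i := by
    intro i hi
    unfold ChordSystem.contrib
    rw [(sys_companion_ρ I hW hG hg₀ hgv hu κ₀ hi x).1, (sys_companion_ρ I hW hG hg₀ hgv hu κ₀ hi x).2]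
  rw [sum_congr rfl hcontrib]
  ext
  · simp; ring
  · simp

/-- **(T3) transfers to the companion.** -/
theorem infeasible_companion (I : LocalMap 4 n m) (hI : I.IsPure xorAndPred) {B : BridgeData n m} (hW : B.WF I) {e : Fin m} (hG : GateHyp I B e)
    {g₀ : Fin m} (hg₀ : g₀ ∈ B.G₁) {u : Fin n} (hgv : (I.vars g₀ 2 = I.vars e 2 ∧ I.vars g₀ 3 = u) ∨ (I.vars g₀ 2 = u ∧ I.vars g₀ 3 = I.vars e 2))
    (hu : u ∉ privs I B.N) (hux : u ∉ xverts I (B.J₀ \ B.N)) (hG₁p : ∀ g ∈ B.G₁.erase g₀, I.vars g 2 ≠ I.vars e 2 ∧ I.vars g 3 ≠ I.vars e 2)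
    (hinf : (sys I B).Infeasible B.N) :
    (sys I (companion I B e g₀ u (decide (I.vars e 2 ∈ B.C₁)))).Infeasible (B.N.erase e) := by
  classical
  intro x s hadm hval
  have hv := val_companion I hI hW hG hg₀ hgv hu hux hG₁p (decide (I.vars e 2 ∈ B.C₁)) x s
  rw [hval, sys_t, companion_b₁, companion_b₂] at hv
  refine hinf x (Function.update s e (1, (sys I B).u e x)) ((sys I B).adm_update hadm (by rw [one_mul])) ?_
  rw [← hv, sys_t]
  ext
  · simp only [Prod.fst_add]
    by_cases h : I.vars e 2 ∈ B.C₁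
    · simp [h]; cases B.b₁ <;> decide
    · simp [h]
  · simp only [Prod.snd_add, add_zero]

/-- **CASE P: chord-minimality transfers to the companion.**  If the original model is single-read at the witness point of a chord-minimality witness
of `e' ≠ e` (CASE P: everywhere), then `e'` is chord-minimal for the companion — at the witness, the read gate is ON, so its first private is on. -/
theorem chordMinimal_companion_of_singleRead (I : LocalMap 4 n m) (hI : I.IsPure xorAndPred) {B : BridgeData n m} (hW : B.WF I) {e : Fin m}
    (hG : GateHyp I B e) {g₀ : Fin m} (hg₀ : g₀ ∈ B.G₁) {u : Fin n}
    (hgv : (I.vars g₀ 2 = I.vars e 2 ∧ I.vars g₀ 3 = u) ∨ (I.vars g₀ 2 = u ∧ I.vars g₀ 3 = I.vars e 2)) (hu : u ∉ privs I B.N)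
    (hux : u ∉ xverts I (B.J₀ \ B.N)) (hG₁p : ∀ g ∈ B.G₁.erase g₀, I.vars g 2 ≠ I.vars e 2 ∧ I.vars g 3 ≠ I.vars e 2)
    (hinf : (sys I B).Infeasible B.N) {e' : Fin m} (he' : e' ∈ B.N.erase e) {a : Fin n → ZMod 2} {s : Fin m → ZMod 2 × ZMod 2}
    (hadm : (sys I B).Adm (B.N.erase e') a s) (hval : (sys I B).val B.N a s = (sys I B).t)
    (hS : ∀ k ∈ B.N, ((sys I B).ρ k a).2 = 0 ∧ ((sys I B).ρ' k a).2 = 0) :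
    (sys I (companion I B e g₀ u (decide (I.vars e 2 ∈ B.C₁)))).ChordMinimal (B.N.erase e) e' := by
  classical
  have he := hG.1
  have hne : e' ≠ e := ne_of_mem_erase he'
  have hse : (sys I B).Adm (B.N.erase e') a s := hadm
  have hstate : (sys I B).contrib a s e = (sys I B).contrib a (Function.update s e (1, (sys I B).u e a)) e := by
    rw [(sys I B).contrib_update_self]
    unfold ChordSystem.contrib
    rw [(gate_reads I hI hG a).2, smul_zero, smul_zero, add_zero, add_zero, one_smul]
    have h01 : ∀ t : ZMod 2, t = 0 ∨ t = 1 := by decide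
    rcases h01 (coef I B.C₁ B.G₁ (I.vars e 2) a) with h0 | h1
    · rw [(gate_reads I hI hG a).1, h0]
      ext <;> simp
    · -- the gate is read: `e` is forced ON on `Z`, so `(s e).1 = 1`
      have hZ : ((sys I B).F a).2 = (sys I B).t.2 := by
        have h := congrArg Prod.snd hval
        unfold ChordSystem.val at h
        rw [Prod.snd_add, Prod.snd_sum] at h
        have h00 : ∑ k ∈ B.N, ((sys I B).contrib a s k).2 = 0 := sum_eq_zero fun k hk => by
          unfold ChordSystem.contrib
          rw [Prod.snd_add, Prod.smul_snd, Prod.smul_snd, (hS k hk).1, (hS k hk).2, smul_zero, smul_zero, add_zero]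
        rw [h00, add_zero] at h
        exact h
      have hread : (sys I B).ρ e a ≠ 0 := by
        rw [(gate_reads I hI hG a).1, h1]; exact fun h => absurd (congrArg Prod.fst h) one_ne_zero
      have hu1 : (sys I B).u e a = 1 := forced_of_singleRead_at (sys I B) hinf hS hZ he (Or.inl hread)
      have hprod : (s e).1 * (s e).2 = 1 := by rw [hse e (mem_erase.2 ⟨hne.symm, he⟩), hu1]
      have hs1 : (s e).1 = 1 := by
        rcases h01 ((s e).1) with h | h
        · rw [h, zero_mul] at hprod; exact absurd hprod (by decide)
        · exact h
      rw [hs1, one_smul]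
  refine ⟨a, s, fun i hi => hadm i (mem_erase.2 ⟨(mem_erase.1 hi).1, mem_of_mem_erase (mem_erase.1 hi).2⟩), ?_⟩
  have hv := val_companion I hI hW hG hg₀ hgv hu hux hG₁p (decide (I.vars e 2 ∈ B.C₁)) a s
  rw [(sys I B).val_eq he, (sys I B).val_erase_update, ← hstate, ← (sys I B).val_eq he, hval, sys_t] at hv
  rw [sys_t, companion_b₁, companion_b₂]
  have hv1 := congrArg Prod.fst hv
  have hv2 := congrArg Prod.snd hv
  simp only [Prod.fst_add, Prod.snd_add, add_zero] at hv1 hv2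
  ext
  · simp only
    by_cases h : I.vars e 2 ∈ B.C₁
    · rw [if_pos h] at hv1; simp only [h, decide_true, Bool.xor_true]
      have e2 : ∀ (v : ZMod 2) (b : Bool), v + 1 = bit b → v = bit (!b) := by decide
      exact e2 _ _ hv1
    · rw [if_neg h, add_zero] at hv1; simp only [h, decide_false, Bool.xor_false]; exact hv1
  · exact hv2

end Summit.PneNP.PneNP.Theorems.PstarGateCompanion
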